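import Summits.Parity.GeneralizedHardyLittlewood.Theorems.LeeYangFibresRelativeDimOneNecessityDefs
import Literature.Barriers.Parity.SiegelZeroDichotomyNoSiegelZeros
import Literature.NumberTheory.LFunctions.SiegelZeroExceptionalPrimesProofs
import Literature.NumberTheory.LFunctions.MertensTail
import Mathlib.NumberTheory.Chebyshev
import Mathlib.NumberTheory.Harmonic.Bounds
import Mathlib.Algebra.BigOperators.Module
import HarnessLib

/-!
# Route `LeeYangFibres`, crux `RelativeDimOne` (stmt-Parity-14113), line `floating-level-core` (lead seat c4):
# UNIFORM CHARACTER PNT EXCLUDES SIEGEL ZEROS — `UniformCharPNT → NoSiegelZeros`, with NO literature debt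

The landed composition of the line (`…FloatingCalibration.lean`, p129131) and the landed necessity
`noSiegelZeros_of_relativeDimOne` (`…AbsoluteUpgradeIllusory.lean`) both reach rh.S34 (`NoSiegelZeros`) through the
VENDORED theorem `Literature.Barriers.Parity.MatomakiMerikoski2023_pairCorrelation` (Matomäki–Merikoski 2023, Thm 1.3;
literature debt). This file proves the necessity side WITHOUT it:

* `not_unboundedSiegelZeros_of_uniformCharPNT : UniformCharPNT → ¬ UnboundedSiegelZeros`,
* `noSiegelZeros_of_uniformCharPNT : UniformCharPNT → NoSiegelZeros`,

from PROVED tree theorems only: Tao–Teräväinen 2022, Proposition 3.5 (3.13)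
(`Literature.NumberTheory.LFunctions.SiegelZero.TaoTeravainen2021_eq313_holds`: for a Siegel zero of quality `η` of a
primitive quadratic `χ mod q`, the primes `p > q` with `χ(p) ≠ −1` have `Σ_{q < p ≤ x} 1/p ≪ (log x/log q)/η`), the explicit
Mertens I of the tree (`MertensBound.sum_log_div_prime_bounds`: `log t − 4 ≤ Σ_{p ≤ t} log p/p ≤ log t + 2`), Mathlib's
Chebyshev bound `ψ(u) − θ(u) ≤ 2√u log u` and Abel summation (`Finset.sum_Ioc_by_parts`).

## The argument

Suppose Siegel zeros of unbounded quality exist and `UniformCharPNT` holds. Take a zero of quality `η ≥ max(η₀, 80K)` at a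
conductor `q ≥ max(N₀, 320⁴ + 1)`; put `s = ⌊√q⌋`, `M = qs`, `N = q²`, `L = log q ≥ 22`, and sum over the primes
`p ∈ (M, N]`:
* Mertens: `S₁ = Σ log p/p ≥ (log N − 4) − (log M + 2) ≥ L/2 − 6`;
* uniform character PNT at conductor `q ≤ u^{3/4}` (`u ∈ [M, N]`, as `u³ ≥ q³s³ ≥ q⁴`) with `ε = 1/40`, plus
  `ψ(u) − θ(u) ≤ u/40`, give `|Σ_{p ≤ u} χ(p) log p| ≤ u/20`; Abel summation then bounds
  `|S_χ| = |Σ χ(p) log p/p| ≤ (3 + log N)/20 = 0.15 + L/10`;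
* but `S₁ + S_χ = Σ (1 + χ(p)) log p/p` is carried by the exceptional primes (`χ(p) ≠ −1`):
  `≤ 2 log N · Σ_{exc, q < p ≤ N} 1/p ≤ 4L · 2K/η ≤ L/10`.
Hence `0.3 L ≤ 6.15`, contradicting `L ≥ 22`.

So every statement of the tree that implies `UniformCharPNT` (the crux `RelativeDimOne`, `UpperRelativeDimOne`,
`CoarseUpperHLSlack`, `PrimeCellsRelative`) PROVES rh.S34 outright (corollaries: `…FloatingCalibrationFree.lean`).
References: Tao–Teräväinen, J. London Math. Soc. 106 (2022), Prop. 3.5 [TaoTeravainen2021]; Hardy–Wright Thm 425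
[HardyWright2008]; Heath-Brown, Proc. LMS 47 (1983) (the exceptional-primes lemma behind Prop. 3.5).
-/

noncomputable section

open Finset Real
open scoped ArithmeticFunction.vonMangoldt Chebyshev

namespace Summit.Parity.GeneralizedHardyLittlewood.Cruxes.RelativeDimOne.FloatingLevelCore

open Summit.Parity.GeneralizedHardyLittlewood.Cruxes.RelativeDimOne.GallagherBackwards (UniformCharPNT charPsi)
open Literature.Barriers.Parity (UnboundedSiegelZeros IsSiegelZero noSiegelZeros_of_not_unboundedSiegelZeros)
open Literature.NumberTheory.LFunctions (NoSiegelZeros)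
open Literature.NumberTheory.LFunctions.SiegelZero (excPrimes mem_excPrimes TaoTeravainen2021_eq313_holds)

namespace NoSiegel

variable {q : ℕ}

/-! ### Abel summation: `|Σ_{M < i ≤ N} g(i)/i| ≤ 2ε(3 + log N)` from `|Σ_{i ≤ u} g(i)| ≤ 2εu` -/

/-- **Abel summation** (by parts against `1/i`). If the partial sums `G(u+1) = Σ_{i ≤ u} g(i)` satisfy
`|G(u+1)| ≤ 2εu` for all `M ≤ u ≤ N` (`1 ≤ M < N`), then `|Σ_{i ∈ (M, N]} g(i)/i| ≤ 2ε(3 + log N)`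
(boundary terms `≤ 2ε` each, and `Σ_{M < i < N} |G(i+1)|/(i(i+1)) ≤ 2ε H_N ≤ 2ε(1 + log N)`). [folklore] -/
theorem abs_sum_div_le_of_partialSums (g : ℕ → ℝ) {M N : ℕ} (hM : 1 ≤ M) (hMN : M < N) {ε : ℝ}
    (hε : 0 ≤ ε) (hB : ∀ u : ℕ, M ≤ u → u ≤ N → |∑ i ∈ range (u + 1), g i| ≤ 2 * ε * u) :
    |∑ i ∈ Ioc M N, g i / i| ≤ 2 * ε * (3 + Real.log N) := by
  have hN0 : (0 : ℝ) < N := by exact_mod_cast (show 0 < N by omega)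
  have hsum : ∑ i ∈ Ioc M N, g i / i = ∑ i ∈ Ioc M N, (fun i : ℕ => (i : ℝ)⁻¹) i • g i := by
    refine Finset.sum_congr rfl fun i _ => ?_
    rw [smul_eq_mul, div_eq_inv_mul]
  rw [hsum, Finset.sum_Ioc_by_parts (fun i : ℕ => (i : ℝ)⁻¹) g hMN]
  have hA : |(N : ℝ)⁻¹ • ∑ i ∈ range (N + 1), g i| ≤ 2 * ε := by
    rw [smul_eq_mul, abs_mul, abs_of_pos (inv_pos.mpr hN0)]
    have := hB N hMN.le le_rfl
    calc (N : ℝ)⁻¹ * |∑ i ∈ range (N + 1), g i| ≤ (N : ℝ)⁻¹ * (2 * ε * N) :=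
          mul_le_mul_of_nonneg_left this (inv_nonneg.mpr hN0.le)
      _ = 2 * ε := by field_simp
  have hBd : |((M + 1 : ℕ) : ℝ)⁻¹ • ∑ i ∈ range (M + 1), g i| ≤ 2 * ε := by
    have hM1 : (0 : ℝ) < ((M + 1 : ℕ) : ℝ) := by positivity
    rw [smul_eq_mul, abs_mul, abs_of_pos (inv_pos.mpr hM1)]
    have := hB M le_rfl hMN.le
    calc ((M + 1 : ℕ) : ℝ)⁻¹ * |∑ i ∈ range (M + 1), g i| ≤ ((M + 1 : ℕ) : ℝ)⁻¹ * (2 * ε * M) :=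
          mul_le_mul_of_nonneg_left this (inv_nonneg.mpr hM1.le)
      _ ≤ ((M + 1 : ℕ) : ℝ)⁻¹ * (2 * ε * ((M + 1 : ℕ) : ℝ)) := by
          refine mul_le_mul_of_nonneg_left ?_ (inv_nonneg.mpr hM1.le)
          refine mul_le_mul_of_nonneg_left ?_ (by positivity)
          push_cast; linarith
      _ = 2 * ε := by field_simp
  have hC : |∑ i ∈ Ioc M (N - 1), (((i + 1 : ℕ) : ℝ)⁻¹ - (i : ℝ)⁻¹) • ∑ j ∈ range (i + 1), g j| ≤
      2 * ε * (1 + Real.log N) := by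
    refine (Finset.abs_sum_le_sum_abs _ _).trans ?_
    have hterm : ∀ i ∈ Ioc M (N - 1),
        |(((i + 1 : ℕ) : ℝ)⁻¹ - (i : ℝ)⁻¹) • ∑ j ∈ range (i + 1), g j| ≤ 2 * ε * (i : ℝ)⁻¹ := by
      intro i hi
      rw [Finset.mem_Ioc] at hi
      have hi0 : (0 : ℝ) < i := by exact_mod_cast (show 0 < i by omega)
      have hi1 : (0 : ℝ) < ((i + 1 : ℕ) : ℝ) := by positivity
      have hdiff : ((i + 1 : ℕ) : ℝ)⁻¹ - (i : ℝ)⁻¹ = -((i : ℝ)⁻¹ * ((i + 1 : ℕ) : ℝ)⁻¹) := by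
        push_cast; field_simp; ring
      rw [smul_eq_mul, abs_mul, hdiff, abs_neg, abs_of_pos (mul_pos (inv_pos.mpr hi0) (inv_pos.mpr hi1))]
      have hb := hB i (by omega) (by omega)
      calc (i : ℝ)⁻¹ * ((i + 1 : ℕ) : ℝ)⁻¹ * |∑ j ∈ range (i + 1), g j|
          ≤ (i : ℝ)⁻¹ * ((i + 1 : ℕ) : ℝ)⁻¹ * (2 * ε * i) :=
            mul_le_mul_of_nonneg_left hb (by positivity)
        _ = 2 * ε * ((i + 1 : ℕ) : ℝ)⁻¹ := by field_simp
        _ ≤ 2 * ε * (i : ℝ)⁻¹ := by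
            refine mul_le_mul_of_nonneg_left ?_ (by positivity)
            exact inv_anti₀ hi0 (by push_cast; linarith)
    refine (Finset.sum_le_sum hterm).trans ?_
    rw [← Finset.mul_sum]
    refine mul_le_mul_of_nonneg_left ?_ (by positivity)
    -- `Σ_{i ∈ (M, N-1]} 1/i ≤ Σ_{i ≤ N} 1/i = H_N ≤ 1 + log N`
    have hsub : Ioc M (N - 1) ⊆ Finset.Icc 1 N := by
      intro i hi
      rw [Finset.mem_Ioc] at hi
      rw [Finset.mem_Icc]; omega
    calc ∑ i ∈ Ioc M (N - 1), (i : ℝ)⁻¹ ≤ ∑ i ∈ Finset.Icc 1 N, (i : ℝ)⁻¹ :=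
          Finset.sum_le_sum_of_subset_of_nonneg hsub fun i _ _ => by positivity
      _ = ((harmonic N : ℚ) : ℝ) := by rw [harmonic_eq_sum_Icc]; push_cast; rfl
      _ ≤ 1 + Real.log N := harmonic_le_one_add_log N
  have hlogN : 0 ≤ Real.log N := Real.log_natCast_nonneg N
  calc |(N : ℝ)⁻¹ • ∑ i ∈ range (N + 1), g i -
          ((M + 1 : ℕ) : ℝ)⁻¹ • ∑ i ∈ range (M + 1), g i -
          ∑ i ∈ Ioc M (N - 1), (((i + 1 : ℕ) : ℝ)⁻¹ - (i : ℝ)⁻¹) • ∑ j ∈ range (i + 1), g j|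
      ≤ |(N : ℝ)⁻¹ • ∑ i ∈ range (N + 1), g i| +
          |((M + 1 : ℕ) : ℝ)⁻¹ • ∑ i ∈ range (M + 1), g i| +
          |∑ i ∈ Ioc M (N - 1), (((i + 1 : ℕ) : ℝ)⁻¹ - (i : ℝ)⁻¹) • ∑ j ∈ range (i + 1), g j| :=
        (abs_sub _ _).trans (by gcongr; exact abs_sub _ _)
    _ ≤ 2 * ε + 2 * ε + 2 * ε * (1 + Real.log N) := by linarith
    _ = 2 * ε * (3 + Real.log N) := by ring

/-! ### The twisted prime weight `g_χ(i) = χ(i) log i · 1[i prime]` against `ψ(u, χ)` -/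

/-- `|Re χ(a)| ≤ 1`. [folklore] -/
theorem abs_re_chi_le_one (χ : DirichletCharacter ℂ q) (a : ZMod q) : |(χ a).re| ≤ 1 :=
  (Complex.abs_re_le_norm _).trans (DirichletCharacter.norm_le_one χ a)

/-- **`θ_χ` against `ψ(·, χ)`**: `|Σ_{p ≤ u} Re χ(p) log p − Re ψ(u, χ)| ≤ ψ(u) − θ(u)` (the prime powers).
[folklore] -/
theorem abs_thetaChi_sub_re_charPsi_le (χ : DirichletCharacter ℂ q) (u : ℕ) :
    |(∑ i ∈ range (u + 1), if i.Prime then (χ (i : ZMod q)).re * Real.log i else 0) - (charPsi χ u).re| ≤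
      ψ (u : ℝ) - θ (u : ℝ) := by
  have hsucc : (∑ i ∈ range (u + 1), if i.Prime then (χ (i : ZMod q)).re * Real.log i else 0) =
      ∑ i ∈ Ioc 0 u, if i.Prime then (χ (i : ZMod q)).re * Real.log i else 0 := by
    rw [Nat.range_succ_eq_Icc_zero, Finset.Icc_eq_cons_Ioc (Nat.zero_le u), Finset.sum_cons,
      if_neg Nat.not_prime_zero, zero_add]
  rw [hsucc, Chebyshev.psi_sub_theta_eq_sum_not_prime, Nat.floor_natCast]
  unfold charPsi
  have hIcc : Finset.Icc 1 u = Ioc 0 u := by simpa using Finset.Icc_add_one_left_eq_Ioc 0 u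
  rw [hIcc, Complex.re_sum, ← Finset.sum_sub_distrib, Finset.sum_filter]
  refine (Finset.abs_sum_le_sum_abs _ _).trans (Finset.sum_le_sum fun i _ => ?_)
  by_cases hp : i.Prime
  · have h0 : (if i.Prime then (χ (i : ZMod q)).re * Real.log i else 0) -
        (((Λ i : ℝ) : ℂ) * χ (i : ZMod q)).re = 0 := by
      rw [Complex.re_ofReal_mul, ArithmeticFunction.vonMangoldt_apply_prime hp, if_pos hp]; ring
    rw [h0, abs_zero]
    simp [hp]
  · simp only [hp, if_false, zero_sub, abs_neg, Complex.re_ofReal_mul, abs_mul,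
      abs_of_nonneg ArithmeticFunction.vonMangoldt_nonneg]
    calc Λ i * |(χ (i : ZMod q)).re| ≤ Λ i * 1 :=
          mul_le_mul_of_nonneg_left (abs_re_chi_le_one χ _) ArithmeticFunction.vonMangoldt_nonneg
      _ = Λ i := mul_one _

/-- Pointwise bound: `‖ψ(u, χ)‖ ≤ εu` and `ψ(u) − θ(u) ≤ εu` give `|Σ_{p ≤ u} Re χ(p) log p| ≤ 2εu`. [folklore] -/
theorem abs_thetaChi_le {χ : DirichletCharacter ℂ q} {u : ℕ} {ε : ℝ}
    (hψ : ‖charPsi χ u‖ ≤ ε * u) (hC : ψ (u : ℝ) - θ (u : ℝ) ≤ ε * u) :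
    |∑ i ∈ range (u + 1), if i.Prime then (χ (i : ZMod q)).re * Real.log i else 0| ≤ 2 * ε * u := by
  have h1 := abs_thetaChi_sub_re_charPsi_le χ u
  have h2 : |(charPsi χ u).re| ≤ ε * u := (Complex.abs_re_le_norm _).trans hψ
  have h3 := abs_add_le
    ((∑ i ∈ range (u + 1), if i.Prime then (χ (i : ZMod q)).re * Real.log i else 0) - (charPsi χ u).re)
    ((charPsi χ u).re)
  rw [sub_add_cancel] at h3
  linarith

/-- **Mertens I over an interval of primes**: `Σ_{p ∈ (M, N]} log p/p ≥ log N − log M − 6` (`1 ≤ M ≤ N`).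
[cite: HardyWright2008, Thm 425] -/
theorem sum_log_div_prime_Ioc_ge {M N : ℕ} (hM : 1 ≤ M) (hMN : M ≤ N) :
    Real.log N - Real.log M - 6 ≤ ∑ i ∈ Ioc M N, (if i.Prime then Real.log i / i else 0) := by
  have hsplit : ∀ n : ℕ, ∑ p ∈ Nat.primesLE n, Real.log p / p =
      ∑ i ∈ Ioc 0 n, (if i.Prime then Real.log i / i else 0) := fun n => by
    rw [Nat.primesLE_eq_filter_Ioc_zero, Finset.sum_filter]
  have hN := (Literature.NumberTheory.LFunctions.MertensBound.sum_log_div_prime_bounds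
    (show (1 : ℝ) ≤ (N : ℝ) by exact_mod_cast hM.trans hMN)).1
  have hMb := (Literature.NumberTheory.LFunctions.MertensBound.sum_log_div_prime_bounds
    (show (1 : ℝ) ≤ (M : ℝ) by exact_mod_cast hM)).2
  rw [Nat.floor_natCast, hsplit] at hN hMb
  have hcons := Finset.sum_Ioc_consecutive (fun i : ℕ => if i.Prime then Real.log i / i else (0 : ℝ))
    (Nat.zero_le M) hMN
  linarith

/-- For `T ≤ M`: `Σ_{p ∈ (M, N]} (1 + Re χ(p)) log p/p ≤ 2 log N · Σ_{p exceptional in (T, N]} 1/p`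
(`1 + Re χ(p) = 0` unless `p` is exceptional, and `≤ 2` always). [folklore] -/
theorem sum_one_add_chi_le (χ : DirichletCharacter ℂ q) {M N T : ℕ} (hTM : T ≤ M) :
    ∑ i ∈ Ioc M N, (if i.Prime then (1 + (χ (i : ZMod q)).re) * Real.log i / i else 0) ≤
      2 * Real.log N * ∑ p ∈ excPrimes χ (Ioc T N), (1 : ℝ) / p := by
  classical
  have hterm : ∀ i ∈ Ioc M N, (if i.Prime then (1 + (χ (i : ZMod q)).re) * Real.log i / i else 0) ≤
      (if i ∈ excPrimes χ (Ioc T N) then 2 * Real.log N * (1 / (i : ℝ)) else 0) := by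
    intro i hi
    rw [Finset.mem_Ioc] at hi
    have hi0 : (0 : ℝ) < i := by exact_mod_cast (show 0 < i by omega)
    have hlogi : 0 ≤ Real.log i := Real.log_natCast_nonneg i
    have hlogiN : Real.log i ≤ Real.log N := Real.log_le_log hi0 (by exact_mod_cast hi.2)
    by_cases hp : i.Prime
    · rw [if_pos hp]
      by_cases hm1 : χ (i : ZMod q) = -1
      · -- `χ(p) = -1`: the term vanishes
        have : (1 + (χ (i : ZMod q)).re) = 0 := by rw [hm1]; simp
        rw [this, zero_mul, zero_div]
        split_ifs <;> positivity
      · have hmem : i ∈ excPrimes χ (Ioc T N) := by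
          rw [mem_excPrimes, Finset.mem_Ioc]
          exact ⟨⟨by omega, hi.2⟩, hp, hm1⟩
        rw [if_pos hmem]
        have hre : (χ (i : ZMod q)).re ≤ 1 := (le_abs_self _).trans (abs_re_chi_le_one χ _)
        rw [mul_div_assoc]
        calc (1 + (χ (i : ZMod q)).re) * (Real.log i / i) ≤ 2 * (Real.log N / i) := by
              refine mul_le_mul (by linarith) (div_le_div_of_nonneg_right hlogiN hi0.le)
                (div_nonneg hlogi hi0.le) (by norm_num)
          _ = 2 * Real.log N * (1 / (i : ℝ)) := by ring
    · rw [if_neg hp]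
      split_ifs <;> positivity
  refine (Finset.sum_le_sum hterm).trans ?_
  rw [← Finset.sum_filter, Finset.mul_sum]
  refine Finset.sum_le_sum_of_subset_of_nonneg (fun i hi => (Finset.mem_filter.mp hi).2) ?_
  intro i _ _
  have : 0 ≤ Real.log N := Real.log_natCast_nonneg N
  positivity

/-- `ψ(u) − θ(u) ≤ u/40` for `u ≥ 320⁴` (from `ψ − θ ≤ 2√u log u` and `log u ≤ 4u^{1/4}`). [folklore] -/
theorem psi_sub_theta_le_div {u : ℝ} (hu : (320 : ℝ) ^ 4 ≤ u) : ψ u - θ u ≤ u / 40 := by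
  have hu0 : 0 < u := lt_of_lt_of_le (by norm_num) hu
  have hu1 : 1 ≤ u := le_trans (by norm_num) hu
  have h1 := Chebyshev.psi_sub_theta_le hu1
  have hlog : Real.log u ≤ u ^ (1 / 4 : ℝ) / (1 / 4) := Real.log_le_rpow_div hu0.le (by norm_num)
  have h14 : (320 : ℝ) ≤ u ^ (1 / 4 : ℝ) := by
    calc (320 : ℝ) = ((320 : ℝ) ^ 4) ^ (1 / 4 : ℝ) := by
          rw [show (1 / 4 : ℝ) = ((4 : ℕ) : ℝ)⁻¹ by norm_num,
            Real.pow_rpow_inv_natCast (by norm_num : (0 : ℝ) ≤ 320) (by norm_num)]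
      _ ≤ u ^ (1 / 4 : ℝ) := Real.rpow_le_rpow (by positivity) hu (by norm_num)
  have hsqrt : Real.sqrt u = u ^ (1 / 2 : ℝ) := Real.sqrt_eq_rpow u
  have hsplit1 : u ^ (1 / 2 : ℝ) * u ^ (1 / 4 : ℝ) = u ^ (3 / 4 : ℝ) := by rw [← Real.rpow_add hu0]; norm_num
  have hsplit2 : u ^ (3 / 4 : ℝ) * u ^ (1 / 4 : ℝ) = u := by rw [← Real.rpow_add hu0]; norm_num
  have h34 : 0 ≤ u ^ (3 / 4 : ℝ) := Real.rpow_nonneg hu0.le _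
  have h12 : 0 ≤ u ^ (1 / 2 : ℝ) := Real.rpow_nonneg hu0.le _
  have hA : 2 * Real.sqrt u * Real.log u ≤ 8 * u ^ (3 / 4 : ℝ) := by
    rw [hsqrt, ← hsplit1]
    have : Real.log u ≤ 4 * u ^ (1 / 4 : ℝ) := by linarith
    nlinarith
  have hB : 8 * u ^ (3 / 4 : ℝ) ≤ u / 40 := by
    rw [le_div_iff₀ (by norm_num : (0 : ℝ) < 40)]
    calc 8 * u ^ (3 / 4 : ℝ) * 40 = 320 * u ^ (3 / 4 : ℝ) := by ring
      _ ≤ u ^ (1 / 4 : ℝ) * u ^ (3 / 4 : ℝ) := mul_le_mul_of_nonneg_right h14 h34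
      _ = u := by rw [mul_comm, hsplit2]
  linarith

/-- `log q ≥ 22` for `q ≥ 320⁴`. [folklore] -/
theorem log_ge_of_large {x : ℝ} (hx : (320 : ℝ) ^ 4 ≤ x) : 22 ≤ Real.log x := by
  have h2 : Real.log 2 > 0.6931471803 := Real.log_two_gt_d9
  have h256 : Real.log ((2 : ℝ) ^ 32) ≤ Real.log x :=
    Real.log_le_log (by positivity) (le_trans (by norm_num) hx)
  rw [Real.log_pow] at h256
  push_cast at h256
  linarith

/-- Conductor versus scale: if `9 ≤ q`, `s = Nat.sqrt q` and `q·s ≤ u` then `q ≤ u^{3/4}`. [folklore] -/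
theorem cast_le_rpow_three_quarters {q u : ℕ} (hq : 9 ≤ q) (hu : q * Nat.sqrt q ≤ u) :
    (q : ℝ) ≤ (u : ℝ) ^ (3 / 4 : ℝ) := by
  set s := Nat.sqrt q with hs
  have hs3 : 3 ≤ s := by rw [hs, Nat.le_sqrt]; omega
  have hq_lt : q < (s + 1) * (s + 1) := Nat.lt_succ_sqrt q
  have hs_cube : q ≤ s * s * s := by nlinarith
  have h4 : q ^ 4 ≤ u ^ 3 := by
    calc q ^ 4 = q ^ 3 * q := by ring
      _ ≤ q ^ 3 * (s * s * s) := Nat.mul_le_mul_left _ hs_cube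
      _ = (q * s) ^ 3 := by ring
      _ ≤ u ^ 3 := Nat.pow_le_pow_left hu 3
  have h4' : ((q : ℝ) ^ 4) ≤ (u : ℝ) ^ 3 := by exact_mod_cast h4
  have hu0 : (0 : ℝ) ≤ u := Nat.cast_nonneg u
  have := Real.rpow_le_rpow (by positivity) h4' (by norm_num : (0 : ℝ) ≤ 1 / 4)
  rw [show (1 / 4 : ℝ) = ((4 : ℕ) : ℝ)⁻¹ by norm_num,
    Real.pow_rpow_inv_natCast (Nat.cast_nonneg q) (by norm_num)] at this
  refine this.trans_eq ?_
  rw [show ((u : ℝ) ^ 3) = (u : ℝ) ^ ((3 : ℕ) : ℝ) by rw [Real.rpow_natCast], ← Real.rpow_mul hu0]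
  norm_num

end NoSiegel

open NoSiegel

/-- A primitive character of modulus `q ≥ 2` is not the trivial character. [folklore] -/
private theorem ne_one_of_isPrimitive' {q : ℕ} [NeZero q] {χ : DirichletCharacter ℂ q}
    (hprim : χ.IsPrimitive) (hq : 2 ≤ q) : χ ≠ 1 := by
  rintro rfl
  rw [DirichletCharacter.isPrimitive_def, DirichletCharacter.conductor_one] at hprim
  omega

/-- **Uniform character PNT excludes Siegel zeros of unbounded quality** — debt-free (Tao–Teräväinen Prop. 3.5 +
Mertens I + Chebyshev + Abel summation; see the module docstring). [cite: TaoTeravainen2021, Proposition 3.5 (3.13)] -/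
theorem not_unboundedSiegelZeros_of_uniformCharPNT (h : UniformCharPNT) : ¬ UnboundedSiegelZeros := by
  intro hU
  obtain ⟨K, η₀, hK⟩ := TaoTeravainen2021_eq313_holds 1 one_pos
  obtain ⟨N₀, hN₀⟩ := h (3 / 4) (by norm_num) (1 / 40) (by norm_num)
  obtain ⟨q, hqne, χ, η, hq, hη, hprim, hquad, h10, hL⟩ := hU (max η₀ (80 * K)) (max N₀ (320 ^ 4 + 1))
  haveI := hqne
  have hqN₀ : N₀ ≤ q := le_trans (le_max_left _ _) hq
  have hq320 : 320 ^ 4 + 1 ≤ q := le_trans (le_max_right _ _) hq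
  have hη₀ : η₀ ≤ η := le_trans (le_max_left _ _) hη
  have hηK : 80 * K ≤ η := le_trans (le_max_right _ _) hη
  have hη0 : 0 < η := by linarith
  have hq9 : 9 ≤ q := le_trans (by norm_num) hq320
  have hq2 : 2 ≤ q := le_trans (by norm_num) hq9
  have hqR : (320 : ℝ) ^ 4 ≤ q := by exact_mod_cast (show 320 ^ 4 ≤ q by omega)
  have hq0 : (0 : ℝ) < q := by positivity
  have hL22 : 22 ≤ Real.log q := log_ge_of_large hqR
  set L := Real.log q with hLdef
  set s := Nat.sqrt q with hs
  set M := q * s with hMdef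
  set N := q * q with hNdef
  have hs1 : 1 ≤ s := by rw [hs, Nat.le_sqrt]; omega
  have hss : s * s ≤ q := Nat.sqrt_le q
  have hsq : s < q := by nlinarith
  have hqM : q ≤ M := Nat.le_mul_of_pos_right q hs1
  have hM1 : 1 ≤ M := le_trans (by omega) hqM
  have hMN : M < N := Nat.mul_lt_mul_of_pos_left hsq (by omega)
  have hN_R : ((N : ℕ) : ℝ) = (q : ℝ) * q := by rw [hNdef]; push_cast; ring
  have hlogN : Real.log N = 2 * L := by rw [hN_R, Real.log_mul hq0.ne' hq0.ne']; ring
  have hlogM : Real.log M ≤ L + L / 2 := by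
    have hs0 : (0 : ℝ) < s := by exact_mod_cast hs1
    have hM_R : ((M : ℕ) : ℝ) = (q : ℝ) * s := by rw [hMdef]; push_cast; ring
    have hlogs : 2 * Real.log s ≤ L := by
      have : Real.log ((s : ℝ) ^ 2) ≤ Real.log q :=
        Real.log_le_log (by positivity) (by exact_mod_cast (show s ^ 2 ≤ q by nlinarith))
      rwa [Real.log_pow, Nat.cast_ofNat] at this
    rw [hM_R, Real.log_mul hq0.ne' hs0.ne']
    linarith
  -- pointwise bound `|θ_χ(u+1)| ≤ u/20` on `[M, N]`
  have hχ1 : χ ≠ 1 := ne_one_of_isPrimitive' hprim hq2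
  set g : ℕ → ℝ := fun i => if i.Prime then (χ (i : ZMod q)).re * Real.log i else 0 with hg
  have hB : ∀ u : ℕ, M ≤ u → u ≤ N → |∑ i ∈ range (u + 1), g i| ≤ 2 * (1 / 40) * u := by
    intro u hMu _
    have huq : q ≤ u := hqM.trans hMu
    have hψ : ‖charPsi χ u‖ ≤ 1 / 40 * u :=
      hN₀ u (hqN₀.trans huq) q hq2 (cast_le_rpow_three_quarters hq9 hMu) χ hχ1
    have hC : ψ (u : ℝ) - θ (u : ℝ) ≤ 1 / 40 * u := by
      have := psi_sub_theta_le_div (hqR.trans (show (q : ℝ) ≤ (u : ℝ) by exact_mod_cast huq))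
      linarith
    exact abs_thetaChi_le hψ hC
  -- (1) Abel: `|S_χ| ≤ (3 + 2L)/20`
  have hSχ := abs_sum_div_le_of_partialSums g hM1 hMN (by norm_num : (0 : ℝ) ≤ 1 / 40) hB
  rw [hlogN] at hSχ
  -- (2) Mertens: `S₁ ≥ L/2 − 6`
  have hS₁ := sum_log_div_prime_Ioc_ge hM1 hMN.le
  rw [hlogN] at hS₁
  -- (3) exceptional primes: `S₁ + S_χ ≤ 2 log N · (2K/η)`
  have hT : ⌊(q : ℝ) ^ ((1 + 1) / 2 : ℝ)⌋₊ = q := by norm_num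
  have hexc := hK q χ hprim hquad η hη₀ hL (N : ℝ) (by
    rw [show ((1 + 1) / 2 : ℝ) = 1 by norm_num, Real.rpow_one]; exact_mod_cast hMN.le.trans' hqM)
  rw [hT, Nat.floor_natCast, hlogN] at hexc
  have hLne : L ≠ 0 := by linarith
  have h2L : 2 * L / Real.log q = 2 := by rw [← hLdef]; field_simp
  rw [h2L] at hexc
  have hSplus := sum_one_add_chi_le χ (N := N) hqM
  rw [hlogN] at hSplus
  have hident : ∑ i ∈ Ioc M N, (if i.Prime then Real.log i / i else 0) + ∑ i ∈ Ioc M N, g i / i =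
      ∑ i ∈ Ioc M N, (if i.Prime then (1 + (χ (i : ZMod q)).re) * Real.log i / i else 0) := by
    rw [← Finset.sum_add_distrib]
    refine Finset.sum_congr rfl fun i _ => ?_
    by_cases hp : i.Prime
    · simp only [hg, hp, if_true]; ring
    · simp [hg, hp]
  have hexcL : 2 * (2 * L) * ∑ p ∈ excPrimes χ (Ioc q N), (1 : ℝ) / p ≤ L / 10 := by
    have hL0 : 0 ≤ L := by linarith
    rcases le_or_gt K 0 with hK0 | hK0
    · have hsum0 : ∑ p ∈ excPrimes χ (Ioc q N), (1 : ℝ) / p ≤ 0 :=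
        hexc.trans (div_nonpos_of_nonpos_of_nonneg (by nlinarith) hη0.le)
      nlinarith
    · have h80 : K * 2 / η ≤ 1 / 40 := by
        rw [div_le_iff₀ hη0]; nlinarith
      nlinarith [hexc.trans h80]
  have habs := abs_le.mp hSχ
  linarith [habs.1, hident]

/-- **`UniformCharPNT → NoSiegelZeros`** (rh.S34: one `c > 0` with `L(σ, χ) ≠ 0` for `σ > 1 − c/log q`, all `q ≥ 3`, all real
primitive `χ mod q`) — with no literature debt. [cite: TaoTeravainen2021, Proposition 3.5 (3.13)] -/
theorem noSiegelZeros_of_uniformCharPNT :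
    Summit.Parity.GeneralizedHardyLittlewood.Cruxes.RelativeDimOne.GallagherBackwards.UniformCharPNT →
      Literature.NumberTheory.LFunctions.NoSiegelZeros :=
  fun h => noSiegelZeros_of_not_unboundedSiegelZeros (not_unboundedSiegelZeros_of_uniformCharPNT h)

end Summit.Parity.GeneralizedHardyLittlewood.Cruxes.RelativeDimOne.FloatingLevelCore

end
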